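import Literature.MathematicalPhysics.QuantumFieldTheory.ConformalBootstrap3D.PointKernelK34L515.Cert
import Literature.MathematicalPhysics.QuantumFieldTheory.ConformalBootstrap3D.PointKernelK34L515.L6C14P0

/-!
# K34L515 instance, cell `l6c14` (final file over parts L6C14P0)

Kernel-v3 cell of the point-functional exclusion instance for the lower box `Δσ ∈ [0.515, 0.520]`,
`Δε ∈ [0.6, 0.95)` (certificate `certL515`, module `PointKernelK34L515.Cert`): spin `ℓ = 6`,
`Δ ∈ [277/32, 309/32)` (centre `A`, half-width `2^-1`), Taylor degree `5`, `n_F = 31`, `1` s-piece(s)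
covering `s = Δσ ∈ [103/200, 13/25]`.  Group theorems `l6c14_part<i>_<a>_<b> : gPart … = some <literal>` are checked by
`decide +kernel` (the literals were produced by `#eval` of the same function); the cell numbers `l6c14_num<i> ≥ 0`
likewise; `l6c14_block` is `PKTM.blockPositive_of_cellPass` applied to them.  Generated by
`gen/mk_v3cell.py` / `gen/drive_v3.py` (typer-g8).  [folklore]
-/

set_option Elab.async false

namespace Literature.MathematicalPhysics.QuantumFieldTheory.ConformalBootstrap3D

namespace PointKernelK34L515

open PointKernel PKTM
open Literature.Analysis.ValidatedNumerics.PolyMP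
open Literature.Analysis.ValidatedNumerics.NumericsMP

/-- cell `l6c14`: spin 6, centre 293/32, half-width 2^-1, Taylor degree 5, n_F = 31 [folklore] -/
def l6c14_cell : TMCell := ⟨6, ((293 : ℚ) / 32), 1, 5, 31, 6, 64, ⟨4, 0, 5, 74, 0, 0⟩⟩

/-- pivots of the HR recursion stay away from zero on the cell [folklore] -/
private theorem l6c14_piv : HRTM.pivOK l6c14_cell.A l6c14_cell.ℓ l6c14_cell.e l6c14_cell.nF = true := by decide +kernel

/-- the cell number of piece 0 is non-negative [folklore] -/
private theorem l6c14_num0 : 0 ≤ cellNumber certL515.S l6c14_cell.h [l6c14_g0_0_11, l6c14_g0_11_22, l6c14_g0_22_33, l6c14_g0_33_34] := by decide +kernel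

/-- piece 0 passes [folklore] -/
private theorem l6c14_pass0 : CellPass certL515 l6c14_cell (pc ps1 0) :=
  cellPass_intro (PartsOK.cons (by decide) l6c14_part0_0_11 (PartsOK.cons (by decide) l6c14_part0_11_22 (PartsOK.cons (by decide) l6c14_part0_22_33 (PartsOK.cons (by decide) l6c14_part0_33_34 (PartsOK.nil _))))) l6c14_num0

/-- **Cell `l6c14`**: spin 6, `Δ ∈ [277/32, 309/32)`, every `s ∈ [103/200, 13/25]`: block positivity of the point
functional of the K34L515 certificate (kernel v3: Taylor models of half-width 2^-1, degree 5, n_F = 31, 1 s-piece(s)).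
[cite: HogervorstRychkov2013, §3 eq. (3.6)] -/
theorem l6c14_block {Q : Set (ℝ × ℝ)}
    (hQ : ∀ q ∈ Q, ((((103 : ℚ) / 200) : ℚ) : ℝ) ≤ q.1 ∧ q.1 ≤ ((((13 : ℚ) / 25) : ℚ) : ℝ))
    (htail : ∀ (j : ℕ) (E : ℝ), (24 : ℝ) ≤ E → (j : ℝ) + 19 / 32 ≤ E → (j : ℝ) ≤ E → ∀ q ∈ Q,
      0 ≤ pointFunctional certL515.wR certL515.zR certL515.zbR (crossF q.1 (-1) (zMono E j))) :
    ∀ q ∈ Q, ∀ Δ ∈ Set.Ico ((277 : ℝ) / 32) ((309 : ℝ) / 32),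
      BlockPositive (pointFunctional certL515.wR certL515.zR certL515.zbR) q.1 Δ 6 :=
  blockPositive_of_cellPass certL515_checkNodes hQ htail (t := l6c14_cell) (by decide) (by decide) (by decide)
    l6c14_piv (by decide +kernel) (by decide +kernel) (P := 1) (by norm_num) certL515_chain1 (cellPass_one l6c14_pass0)
    (by norm_num [l6c14_cell, TMCell.h]) (by norm_num [l6c14_cell, TMCell.h])
    (by norm_num [l6c14_cell]) (by norm_num [l6c14_cell, unitarityBound3D]) (by norm_num [l6c14_cell])

end PointKernelK34L515

end Literature.MathematicalPhysics.QuantumFieldTheory.ConformalBootstrap3D
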